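import Literature.MathematicalPhysics.QuantumFieldTheory.Balaban1983to89.B9Thm313WholeDirL2Z

/-!
# `Balaban1983to89.B9Thm313WholeL2MixedCut` — [B9] Theorem 3.13 (p. 426): the MIXED block-L² member (3.46)₃ ∇_{U,ν}𝔊∇\*_{U,μ} per direction pair
# and on the pair family (`B9Thm313WholeDirL2Z.GG_l2bd_mixed ∕ mixedFamily_of_lettersZ`) RE-ISSUED over the four KEPT fields `gDv gQs c1 q` of
# `Letters313L2PZ` they read, as separate hypotheses — reader layer under the N06 LETTERS-SPECIES re-cut (WANTED №g26-7), L²-side companion of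
# `B9Thm313WholeSupReadersCut ∕ Probe43LCut ∕ DirInputBZCut`

T. Bałaban, *Propagators for lattice gauge theories in a background field*, Commun. Math. Phys. **99** (1985) 389–434
[`Balaban1985BackgroundPropagators`, "B9"]; [4] = T. Bałaban, *Propagators and renormalization transformations for lattice gauge
theories. II*, Commun. Math. Phys. **96** (1984) 223–250 [`Balaban1984PropagatorsII`].

statement-level skeleton of published theorems with citation tags; proofs where landed; nothing here is a claim about the Yang–Mills
mass gap

THE PRINTED LOCUS (held text `paper:balaban1985-cmp99-background-propagators`).  p. 426, (3.153): *"𝔊 = G₁ − G₁DRD\*G₁ − G₁Q\*(QG₁Q\*)⁻¹QG₁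
= G₁𝔓\* = 𝔓G₁"*; Theorem 3.13 p. 426 (Theorem 3.3 holds for 𝔊, hence the block-L² line (3.46) p. 398; (3.39) p. 397 *"max_{μ,ν}"*).

THE POINT (cell `pub/ym-inputs` seat p04 g2, LOCATE «READER LAYER» 2026-08-28T11:03Z on `pub/pub-ymgap/INBOX.md`; hazard «N06-LETTERS-SPECIES»
of ★★OWNER ym3-torus-plan RULING g26-№21 (5), WANTED №g26-7; the cut SCHEMA and the composites are dag-n06-l g19's).  The located block-L²
fields `Letters313L2PZ.ddGDv ∕ rgdDds` are read only by `GG_l2bd_family3Z ∕ family5Z`, already re-cut without them (`B9Thm313WholeL2DerivCut`); the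
Laplacian-class readers `GG_l2bd_entry3Z∕4Z∕5Z ∕ leftZ ∕ rightZ` take `Letters313L2Z` through `Letters313L2PZ.toLap`, which copies only kept fields, so
they need no re-issue.  The remaining reader of the pair record under the Theorem-3.13 leaf — the MIXED member `GG_l2bd_mixed_of_lettersZ` (called for
every pair by `…mixedFamily…`, which `B9Thm313WholeBlocksPairMZ.GG_l2Block_pairMZ` :257 consumes) — reads ONLY `gDv gQs c1 q` but takes the WHOLE
record `hLt : Letters313L2PZ …`.  THIS FILE re-issues it (and the family packaging) with the record binder replaced by EXACTLY those four fields as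
hypotheses `hLgDv hLgQs hLc1 hLq` (types VERBATIM, placed where `hLt` was; `vZ hvZ` stay implicit — the untouched `hLM : Letters313L2MZ … vZ hvZ U`
fixes them); `hL : Thm33G0L2M`, `hT`, `hLM`, `hI` and the constant `constG46 (constKp B₂ B₄ θ c) c` byte-identical; proofs = the parents' with
`hLt.x ↦ hLx`:
* ★ `GG_l2bd_mixed_cut_of_letters`, ★ `GG_l2bd_mixedFamily_cut_of_letters`.
The parents follow by projection; a cut schema (dag-n06-l's `Letters313L2Pc`) feeds them by its projections.

HONEST SCOPE.  Kernel bookkeeping over landed modules (`entry_l2w_of_step`, `hasMaj_frakG_classes`, `blockBd_familyOp`); the kept letters stay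
HYPOTHESES of printed species; nothing of [B9]'s estimates is asserted; COUNT-NEUTRAL; N06 NOT discharged; no summit or sub-problem statement is
proved (YM₃ on T³ = ladder rung R3, a RECORD rung — not T⁴, not a mass gap, not Clay).  One finite lattice at a time.  Seat `ym-inputs-p04` g2
(prover-ym-inputs-p04-g2-0), 2026-08-28; NEW file, nothing landed is modified.
-/

namespace Literature.MathematicalPhysics.QuantumFieldTheory.Balaban1983to89.B9Thm313WholeL2MixedCut

open Literature.MathematicalPhysics.QuantumFieldTheory.Balaban1983to89
open Finset B6RandomWalk B6RandomWalkHom B9Thm34Ext B9Thm37GlueCor36 B11SectG B9SectDSup B9Thm37AllNorms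
open B9Thm37AllNormsInstances B9FromB6 B9SectBStepWhole B9Thm312Whole B9Thm312WholeLeaf B9Thm312WholeLeft B9Thm313Whole B9Thm313WholeLeft
open B9Thm37Glue B9SectDL2Decay B9RWSums343Holder B9Ineq347 B9Thm312WholeClasses B9Thm312WholeL2 B9Thm312WholeBlocksRel B9Thm312WholeBlocksNbr
open B9Thm312WholeHolder B9Thm312WholeHHolder B9Thm313WholeHolder B9Thm313WholeL2G B9Thm313WholeL2GP B9RWSums346SecondDiff B9Thm312WholeDir B9Thm313WholeDir
open B9Thm313WholeL2GZ B9Thm313WholeL2GPZ B9Thm313WholeDirL2Z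

noncomputable section

section OneMember

variable {g : B9.Geometry} {B : B9.Backgrounds} {X Y Z W PX PY P : Type}
variable [Fintype X] [Fintype Y] [Fintype Z] [Fintype W] [Fintype PX] [Fintype PY] [Fintype P] [Fintype g.Site]
variable {R₀ : ℝ} {H₀ : Prop}

omit [Fintype P] in
/-- ★ (**KEPT-FIELD RE-ISSUE** of `B9Thm313WholeDirL2Z.GG_l2bd_mixed_of_lettersZ`: the binder `hLt : Letters313L2PZ …` replaced by its fields `gDv` (G₀D), `gQs` (G₀Q\*), `c1` ((QG₁Q\*)⁻¹), `q` (Q) as block-L² hypotheses, types verbatim; `hLM : Letters313L2MZ …` and every other binder, the conclusion and the constant unchanged; proof verbatim) **(3.46), THE MIXED MEMBER FOR 𝔊 = 𝔓G₁ PER DIRECTION PAIR, AS A BLOCK-L² BOUND** — ‖1_{Δ(y)}∇_{U,ν}𝔊∇\*_{U,μ}f‖₂ ≦ K·e^{−ρd(y,y′)}‖f‖₂ for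
supp f ⊂ Δ(y′): (3.153) with E = ∇_{U,ν}, F = ∇\*_{U,μ} (`E_GG_F_eq`), the G₁-entries ∇_νG₁∇\*_μ, ∇_νG₁Dv, ∇_νG₁Q\*, G₁∇\*_μ by r1's Neumann bookkeeping from
Theorem 3.3 for G₀ per direction (`Thm33G0L2M.l1d ∕ l2d ∕ l4m` + the letters `gDv ∕ gQs` and `Letters313L2M.dGDvd ∕ dGQsd`) and the step
(`entry_l2w_of_step`), the letters RDv\*G₁∇\*_μ (`rgdDd`), C₁, Q (`Letters313L2P`), composed by `hasMaj_frakG_classes` in the block-L² classes (all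
cutting costs 1) with [4] (2.61) as the row sum; provisos ρ + 5σ ≦ δ, B₂θc² < 1; K = `constG46 (constKp B₂ B₄ θ c) c` — the per-pair twin of
`B9Thm313WholeL2G.GG_l2bd_entry4` (there for the bundled ∇_U𝔊∇\*_U on the lattice Y).
[cite: Balaban1985BackgroundPropagators, Thm 3.13 p.426 + (3.153) p.426 + (3.46) p.398 + (3.39) p.397 + Thm 3.12 p.423; Balaban1984PropagatorsII, Lemma 2.1 (2.61) p.234] -/
theorem GG_l2bd_mixed_cut_of_letters (hG : GeoOK g) {𝔬 : Ops g B X Y Z W} {Dd Dds : B.Cfg → P → Module.End ℝ (X → ℝ)} {U : B.Cfg}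
    {B₂ B₄ θ δ ρ σ c : ℝ} (hrow : RowSum (toB6 g R₀ H₀) σ c) (hB₂ : 0 ≤ B₂) (hB₄ : 0 ≤ B₄) (hθ : 0 ≤ θ) (hρ : 0 ≤ ρ)
    (hσ : 0 ≤ σ) (hρδ : ρ + 5 * σ ≤ δ) (hL : Thm33G0L2M 𝔬 Dd Dds R₀ H₀ B₂ δ U)
    (hT : BlockBd (g := toB6 g R₀ H₀) 𝔬.blk 𝔬.blk (𝔬.Tpi U + 𝔬.T2 U)
      (fun (y y' : g.Site) => θ * (g.len y)⁻¹ * (g.len y')⁻¹ * Real.exp (-(δ * g.dist y y'))))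
    {vZ : g.Site → ℝ} {hvZ : ∀ y, 0 < vZ y}
    (hLgDv : BlockBd (g := toB6 g R₀ H₀) 𝔬.blkW 𝔬.blk (𝔬.G0 U ∘ₗ 𝔬.Dv U)
      (fun (y y' : g.Site) => B₄ * g.len y * Real.exp (-(δ * g.dist y y'))))
    (hLgQs : BlockBd (g := toB6 g R₀ H₀) 𝔬.blkZ 𝔬.blk (𝔬.G0 U ∘ₗ 𝔬.Qstar U)
      (fun (y y' : g.Site) => B₄ * g.len y * (vZ y' * g.len y') * Real.exp (-(δ * g.dist y y'))))
    (hLc1 : BlockBd (g := toB6 g R₀ H₀) 𝔬.blkZ 𝔬.blkZ (𝔬.C1 U)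
      (fun (y y' : g.Site) => B₄ * (vZ y * g.len y)⁻¹ * (vZ y' * g.len y')⁻¹ * Real.exp (-(δ * g.dist y y'))))
    (hLq : BlockBd (g := toB6 g R₀ H₀) 𝔬.blk 𝔬.blkZ (𝔬.Q U)
      (fun (y y' : g.Site) => B₄ * (vZ y * g.len y * (g.len y')⁻¹) * Real.exp (-(δ * g.dist y y'))))
    (hLM : Letters313L2MZ 𝔬 Dd Dds R₀ H₀ B₄ δ vZ hvZ U) (hI : Identities 𝔬 U)
    (hq : B₂ * θ * c * c < 1) (ν μ : P) :
    BlockBd (g := toB6 g R₀ H₀) 𝔬.blk 𝔬.blk (Dd U ν ∘ₗ (𝔬.GG U ∘ₗ Dds U μ))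
      (fun (y y' : g.Site) => constG46 (constKp B₂ B₄ θ c) c * Real.exp (-(ρ * g.dist y y'))) := by
  -- adapted from `B9Thm313WholeL2G.GG_l2bd_entry4` (∇_U ↦ ∇_{U,ν}, ∇\*_U ↦ ∇\*_{U,μ}, lattice Y ↦ X)
  have hc : 0 ≤ c ∨ IsEmpty g.Site := by
    by_cases hne : Nonempty g.Site
    · exact Or.inl (hrow.nonneg hne.some)
    · exact Or.inr (not_nonempty_iff.mp hne)
  rcases hc with hc | hemp
  swap
  · intro y' μ' hμ y
    exact (hemp.false y).elim
  have htri : Triangle254 (toB6 g R₀ H₀) := fun a b c => hG.tri a b c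
  have hW1 : ∀ y : g.Site, 0 < (fun _ : g.Site => (1 : ℝ)) y := fun _ => one_pos
  have hWl : ∀ y : g.Site, 0 < (fun y : g.Site => g.len y) y := fun y => hG.lenpos y
  have hWi : ∀ y : g.Site, 0 < (fun y : g.Site => (g.len y)⁻¹) y := fun y => inv_pos.mpr (hG.lenpos y)
  have hWv : ∀ y : g.Site, 0 < (fun y : g.Site => vZ y * g.len y) y := fun y => mul_pos (hvZ y) (hG.lenpos y)
  have hWvi : ∀ y : g.Site, 0 < (fun y : g.Site => (vZ y * g.len y)⁻¹) y := fun y => inv_pos.mpr (mul_pos (hvZ y) (hG.lenpos y))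
  have hfix : 𝔬.G1 U = 𝔬.G0 U + 𝔬.G0 U ∘ₗ (𝔬.Tpi U + 𝔬.T2 U) ∘ₗ 𝔬.G1 U := fix_of_inverses hI.invG0' hI.invG1
  have hLap : Thm33G0L2 𝔬 (fun _ => (0 : Module.End ℝ (X → ℝ))) R₀ H₀ B₂ δ U := Thm33G0L2P.toLap hB₂ hG.lenle hL.toThm33G0L2P
  -- constants
  have hS0 : 0 ≤ B₂ + B₄ := add_nonneg hB₂ hB₄
  have hS₂ : B₂ ≤ B₂ + B₄ := by linarith
  have hS₄ : B₄ ≤ B₂ + B₄ := by linarith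
  obtain ⟨hKp0, -⟩ := constP_nonneg_le hθ hc hq hS0 hS0 hS0 le_rfl le_rfl le_rfl
  obtain ⟨hP₂0, hP₂le⟩ := constP_nonneg_le hθ hc hq hB₂ hB₂ hB₂ hS₂ hS₂ hS₂
  obtain ⟨hP₄0, hP₄le⟩ := constP_nonneg_le hθ hc hq hB₄ hB₂ hB₄ hS₄ hS₂ hS₄
  have hB₄K : B₄ ≤ constP B₂ θ c (B₂ + B₄) (B₂ + B₄) (B₂ + B₄) := by
    have hq1 : 0 ≤ (1 - B₂ * θ * c * c)⁻¹ := inv_nonneg.mpr (by linarith)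
    have h0 : 0 ≤ (B₂ + B₄) * (θ * ((B₂ + B₄) * (1 - B₂ * θ * c * c)⁻¹) * c) * c :=
      mul_nonneg (mul_nonneg hS0 (mul_nonneg (mul_nonneg hθ (mul_nonneg hS0 hq1)) hc)) hc
    unfold constP; linarith
  have hKK0 : 0 ≤ constP B₂ θ c (B₂ + B₄) (B₂ + B₄) (B₂ + B₄) * constP B₂ θ c (B₂ + B₄) (B₂ + B₄) (B₂ + B₄) * c :=
    mul_nonneg (mul_nonneg hKp0 hKp0) hc
  -- rates
  have hr₁0 : 0 ≤ ρ + 3 * σ := by linarith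
  have hr₁δ : ρ + 3 * σ + 2 * σ ≤ δ := by linarith
  have hr₂0 : 0 ≤ ρ + 2 * σ := by linarith
  have hr₂1 : ρ + 2 * σ ≤ ρ + 3 * σ := by linarith
  have hr₂δ' : ρ + 2 * σ + σ ≤ δ := by linarith
  have hr₂δ : ρ + 2 * σ ≤ δ := by linarith
  have hρr₂ : ρ + 2 * σ ≤ ρ + 2 * σ := le_rfl
  -- the G₁-entries ∇_νG₁∇*_μ, ∇_νG₁Dv, ∇_νG₁Q*, G₁∇*_μ by r1's Neumann bookkeeping, at the rate ρ + 3σ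
  have pG := entry_l2w_of_step hG hW1 hW1 (Eop := Dd U ν) (Fop := Dds U μ) (aS := B₂) (aE := B₂) (aEF := B₂) hrow hB₂ hθ
    hB₂ hB₂ hB₂ hr₁0 hσ hr₁δ hLap hT ((hL.l2d μ).mono fun y y' => le_of_eq (by ring))
    ((hL.l1d ν).mono fun y y' => le_of_eq (by ring)) ((hL.l4m (ν, μ)).mono fun y y' => le_of_eq (by ring)) hfix hq
  have pGD := entry_l2w_of_step hG hW1 hW1 (Eop := Dd U ν) (Fop := 𝔬.Dv U) (aS := B₄) (aE := B₂) (aEF := B₄) hrow hB₂ hθ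
    hB₄ hB₂ hB₄ hr₁0 hσ hr₁δ hLap hT (hLgDv.mono fun y y' => le_of_eq (by ring)) ((hL.l1d ν).mono fun y y' => le_of_eq (by ring))
    ((hLM.dGDvd ν).mono fun y y' => le_of_eq (by ring)) hfix hq
  have pGQ := entry_l2w_of_step hG hWv hW1 (Eop := Dd U ν) (Fop := 𝔬.Qstar U) (aS := B₄) (aE := B₂) (aEF := B₄) hrow hB₂ hθ
    hB₄ hB₂ hB₄ hr₁0 hσ hr₁δ hLap hT (hLgQs.mono fun y y' => le_of_eq (by ring)) ((hL.l1d ν).mono fun y y' => le_of_eq (by ring))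
    ((hLM.dGQsd ν).mono fun y y' => le_of_eq (by ring)) hfix hq
  have pGDs := entry_l2w_of_step hG hW1 hWi (Eop := LinearMap.id) (Fop := Dds U μ) (aS := B₂) (aE := B₂) (aEF := B₂) hrow
    hB₂ hθ hB₂ hB₂ hB₂ hr₁0 hσ hr₁δ hLap hT ((hL.l2d μ).mono fun y y' => le_of_eq (by ring))
    (by rw [LinearMap.id_comp]; exact hL.l0.mono fun y y' => le_of_eq (by rw [inv_inv]; ring))
    (by rw [LinearMap.id_comp]; exact (hL.l2d μ).mono fun y y' => le_of_eq (by rw [inv_inv]; ring)) hfix hq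
  rw [LinearMap.id_comp] at pGDs
  -- the letters RDv*G₁∇*_μ, C₁, Q in the block-L² classes
  have pRG : HasMaj (l2w (toB6 g R₀ H₀) 𝔬.blk (fun _ : g.Site => (1 : ℝ)) fun y => (hW1 y).le)
      (l2w (toB6 g R₀ H₀) 𝔬.blkW (fun _ : g.Site => (1 : ℝ)) fun y => (hW1 y).le)
      (𝔬.R U ∘ₗ 𝔬.Dvstar U ∘ₗ 𝔬.G1 U ∘ₗ Dds U μ) (fun y y' => B₄ * Real.exp (-(δ * g.dist y y'))) :=
    hasMaj_l2w_of_blockBd_ratio (g := toB6 g R₀ H₀) hW1 hW1 ((hLM.rgdDd μ).mono fun y y' => le_of_eq (by ring))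
  have pC : HasMaj (l2w (toB6 g R₀ H₀) 𝔬.blkZ (fun y : g.Site => (vZ y * g.len y)⁻¹) fun y => (hWvi y).le)
      (l2w (toB6 g R₀ H₀) 𝔬.blkZ (fun y : g.Site => vZ y * g.len y) fun y => (hWv y).le)
      (𝔬.C1 U) (fun y y' => B₄ * Real.exp (-(δ * g.dist y y'))) :=
    hasMaj_l2w_of_blockBd_ratio (g := toB6 g R₀ H₀) hWvi hWv (hLc1.mono fun y y' => le_of_eq (by ring))
  have pQ : HasMaj (l2w (toB6 g R₀ H₀) 𝔬.blk (fun y : g.Site => (g.len y)⁻¹) fun y => (hWi y).le)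
      (l2w (toB6 g R₀ H₀) 𝔬.blkZ (fun y : g.Site => (vZ y * g.len y)⁻¹) fun y => (hWvi y).le)
      (𝔬.Q U) (fun y y' => B₄ * Real.exp (-(δ * g.dist y y'))) :=
    hasMaj_l2w_of_blockBd_ratio (g := toB6 g R₀ H₀) hWi hWvi (hLq.mono fun y y' => le_of_eq (by rw [inv_inv]; ring))
  -- QG₁∇*_μ at the rate ρ + 2σ
  have pQG := hasMaj_comp_exp htri hG.dnn hrow hB₄ hP₂0 hr₂0 hr₂1 hr₂δ' pQ pGDs
  simp only [l2w_κ, one_mul] at pQG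
  -- everything at (K_p, ρ + 2σ), the composite at K_p²c
  have uG := hasMaj_up hG hP₂0 hP₂le hr₂1 pG
  have uGD := hasMaj_up hG hP₄0 hP₄le hr₂1 pGD
  have uRG := hasMaj_up hG hB₄ hB₄K hr₂δ pRG
  have uGQ := hasMaj_up hG hP₄0 hP₄le hr₂1 pGQ
  have uC := hasMaj_up hG hB₄ hB₄K hr₂δ pC
  have uQG := hasMaj_up hG (mul_nonneg (mul_nonneg hB₄ hP₂0) hc)
    (mul_le_mul_of_nonneg_right (mul_le_mul hB₄K hP₂le hP₂0 hKp0) hc) hρr₂ pQG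
  -- (3.153) composed in the block-L² classes
  have hfr := hasMaj_frakG_classes htri hG.dnn hrow hKp0 hKp0 hKp0 hKp0 hKp0 hKK0 hρ hσ hρr₂ uG uGD uRG uGQ uC uQG
  have hGG := hfr.congr (T' := Dd U ν ∘ₗ (𝔬.GG U ∘ₗ Dds U μ)) fun f => by rw [E_GG_F_eq hI (Dd U ν) (Dds U μ)]
  have hbd := blockBd_of_hasMaj_l2w hGG hW1
  refine hbd.mono fun y y' => le_of_eq ?_
  simp only [l2w_κ, one_mul, toB6_dist, constG46, constKp, mul_one, div_one]

/-- ★ (**KEPT-FIELD RE-ISSUE** of `B9Thm313WholeDirL2Z.GG_l2bd_mixedFamily_of_lettersZ` over the four kept fields `gDv gQs c1 q`; otherwise verbatim) **(3.46)₃ OF THE RECORD (THE MIXED MEMBER) FOR 𝔊 AS THE PACKAGED PAIR FAMILY ∇_{U,ν}𝔊∇\*_{U,μ}** — one model X → X × (P × P) with block map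
`blk ∘ Prod.fst` (n06-k's `familyOp`, the species of the v4 face's `hl3`), block bound √|P × P|·K·e^{−ρd(y,y′)}: `GG_l2bd_mixed_of_letters` for
every pair, then `blockBd_familyOp` ((3.39): *"max_{μ,ν}"* is dominated by the packaged family).
[cite: Balaban1985BackgroundPropagators, Thm 3.13 p.426 + (3.46) p.398 + (3.39) p.397; Balaban1984PropagatorsII, Lemma 2.1 p.234] -/
theorem GG_l2bd_mixedFamily_cut_of_letters (hG : GeoOK g) {𝔬 : Ops g B X Y Z W} {Dd Dds : B.Cfg → P → Module.End ℝ (X → ℝ)} {U : B.Cfg}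
    {B₂ B₄ θ δ ρ σ c : ℝ} (hrow : RowSum (toB6 g R₀ H₀) σ c) (hc : 0 ≤ c) (hB₂ : 0 ≤ B₂) (hB₄ : 0 ≤ B₄) (hθ : 0 ≤ θ) (hρ : 0 ≤ ρ)
    (hσ : 0 ≤ σ) (hρδ : ρ + 5 * σ ≤ δ) (hL : Thm33G0L2M 𝔬 Dd Dds R₀ H₀ B₂ δ U)
    (hT : BlockBd (g := toB6 g R₀ H₀) 𝔬.blk 𝔬.blk (𝔬.Tpi U + 𝔬.T2 U)
      (fun (y y' : g.Site) => θ * (g.len y)⁻¹ * (g.len y')⁻¹ * Real.exp (-(δ * g.dist y y'))))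
    {vZ : g.Site → ℝ} {hvZ : ∀ y, 0 < vZ y}
    (hLgDv : BlockBd (g := toB6 g R₀ H₀) 𝔬.blkW 𝔬.blk (𝔬.G0 U ∘ₗ 𝔬.Dv U)
      (fun (y y' : g.Site) => B₄ * g.len y * Real.exp (-(δ * g.dist y y'))))
    (hLgQs : BlockBd (g := toB6 g R₀ H₀) 𝔬.blkZ 𝔬.blk (𝔬.G0 U ∘ₗ 𝔬.Qstar U)
      (fun (y y' : g.Site) => B₄ * g.len y * (vZ y' * g.len y') * Real.exp (-(δ * g.dist y y'))))
    (hLc1 : BlockBd (g := toB6 g R₀ H₀) 𝔬.blkZ 𝔬.blkZ (𝔬.C1 U)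
      (fun (y y' : g.Site) => B₄ * (vZ y * g.len y)⁻¹ * (vZ y' * g.len y')⁻¹ * Real.exp (-(δ * g.dist y y'))))
    (hLq : BlockBd (g := toB6 g R₀ H₀) 𝔬.blk 𝔬.blkZ (𝔬.Q U)
      (fun (y y' : g.Site) => B₄ * (vZ y * g.len y * (g.len y')⁻¹) * Real.exp (-(δ * g.dist y y'))))
    (hLM : Letters313L2MZ 𝔬 Dd Dds R₀ H₀ B₄ δ vZ hvZ U) (hI : Identities 𝔬 U)
    (hq : B₂ * θ * c * c < 1) :
    BlockBd (g := toB6 g R₀ H₀) 𝔬.blk (𝔬.blk ∘ Prod.fst) (familyOp (fun q : P × P => Dd U q.1 ∘ₗ (𝔬.GG U ∘ₗ Dds U q.2)))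
      (fun (y y' : g.Site) => Real.sqrt (Fintype.card (P × P)) * (constG46 (constKp B₂ B₄ θ c) c *
        Real.exp (-(ρ * g.dist y y')))) := by
  have hS0 : 0 ≤ B₂ + B₄ := add_nonneg hB₂ hB₄
  have hKp0 : 0 ≤ constKp B₂ B₄ θ c := (constP_nonneg_le hθ hc hq hS0 hS0 hS0 le_rfl le_rfl le_rfl).1
  have hK0 : 0 ≤ constG46 (constKp B₂ B₄ θ c) c := constG46_nonneg hKp0 hc
  exact blockBd_familyOp (R := R₀) (H := H₀) 𝔬.blk 𝔬.blk
    (fun a b => mul_nonneg hK0 (Real.exp_nonneg _))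
    fun q => GG_l2bd_mixed_cut_of_letters hG hrow hB₂ hB₄ hθ hρ hσ hρδ hL hT hLgDv hLgQs hLc1 hLq hLM hI hq q.1 q.2

end OneMember

end

end Literature.MathematicalPhysics.QuantumFieldTheory.Balaban1983to89.B9Thm313WholeL2MixedCut
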